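import Summits.CriticalPhenomena.Ising3DConformalLimit.Theses.ReflectionTwin
import Summits.CriticalPhenomena.Ising3DConformalLimit.Theorems.MarkovRigidityCubicSymmetryOfLimit
import HarnessLib

/-!
# Item stmt-CriticalPhenomena-16907 `ReflectionTwin.CubicSymmetryOfLimit` — proved (by-name alias of item 6229)

Route `ReflectionTwin` (sub-problem `CriticalPhenomena/Ising3DConformalLimit`), support item: every limit `(ρ, Δ, S)` as in
`ExistsScaleCovariantLimit` (normalised, non-degenerate, translation invariant, scale covariant) is invariant under the
hyperoctahedral group `B₃` of linear isometries permuting `{±eᵢ}`. The statement is, verbatim, the shared item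
stmt-CriticalPhenomena-6229 `MarkovRigidity.CubicSymmetryOfLimit`, PROVED in the tree
(`MarkovRigidityCubicSymmetry.cubicSymmetryOfLimit_proof`: lattice `B₃`-symmetry of `criticalCorr 3` + translation
invariance of the limit at rounding ties). Recorded by the lead of line `Sketch` of this route's existence crux
(stmt-4582), as the grounder's attached closure (g79-3). [folklore]
-/

namespace Summit.CriticalPhenomena.Ising3DConformalLimit.ReflectionTwinCubicSymmetryOfLimit

/-- **Item stmt-CriticalPhenomena-16907**: `ReflectionTwin.CubicSymmetryOfLimit` (= item 6229, by `Iff.rfl`). [folklore] -/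
theorem cubicSymmetryOfLimit_proof :
    Summit.CriticalPhenomena.Ising3DConformalLimit.Theses.ReflectionTwin.CubicSymmetryOfLimit :=
  Summit.CriticalPhenomena.Ising3DConformalLimit.MarkovRigidityCubicSymmetry.cubicSymmetryOfLimit_proof

end Summit.CriticalPhenomena.Ising3DConformalLimit.ReflectionTwinCubicSymmetryOfLimit
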